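import Summits.NavierStokesRegularity.NavierStokesRegularity.Theorems.PoloidalWindowDoorPoloidalWindowRigidityZShockRotatingProfileLinearWitnessCalculus
import HarnessLib

/-!
# Crux K2 `PoloidalWindowRigidity` (stmt-NavierStokesRegularity-19708), line `z_shock` — R3 inhabitant census: ROTATING PATTERNS of the
# autonomous thick height-evolution (VII) — TIGHTNESS: without thickness the rotating-pattern equation IS inhabited (a bounded
# non-constant entire rotating profile in the linearly degenerate case `γ ≡ c²`)

`--supports stmt-NavierStokesRegularity-19708 --as helper` (leafhand-ns-poloidalwindowdoor-3 g9, cell decomp-ns, 2026-08-31).  Class-free,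
def-free; Mathlib + parts I (`…ZShockRotatingProfile`) and VIIa (`…LinearWitnessCalculus`).  **No stub and no summit is closed by this file;
Navier–Stokes regularity is NOT proved here (rung 0).**  A NEGATIVE / tightness fact about the census item «rotating patterns» (evidence #47
ROTATING-ENTRANCE-leafhand-3-g9.md §2(b), brick F0): it shows which hypothesis of the would-be rigidity lemma is load-bearing.

WHY THIS FILE.  Parts I–VI typed the rotating-pattern inhabitant candidates `W(s,y) = Ψ(R_{ωs}y)` of the autonomous column by the profile equation
`ω² ΘΘΨ = Σᵢ ∂ᵢ(γ(Ψ)∂ᵢΨ)` and proved the radial case and the circle laws; the remaining rigidity claim («bounded `C²` profiles are radial, hence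
constant») carries the THICK clause `γ' ≢ 0` on every interval (genuine nonlinearity).  This file proves that the clause cannot be dropped: in the
linearly degenerate case `γ ≡ c²` (`c ≠ 0`, any rotation rate `ω ≠ 0`) the plane-wave superposition

  `Ψ(y) = ∫₀^{2π} cos(k (y₀ cos t + y₁ sin t) − t) dt`,  `k = ω/c`

(a `2π J₁(k|y|) sin θ`-type Bessel spiral mode, written without Bessel functions) is a `C²`, bounded, NON-CONSTANT solution of
`ω² ΘΘΨ = Σᵢ ∂ᵢ(c² ∂ᵢΨ)` on the whole plane — a genuine rotating inhabitant of the LINEAR height-evolution `w_ss = c²Δw` (by part III it rotates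
into a slice solution at every height).  So rotating rigidity, if true, is a cumulative genuinely-nonlinear effect; any proof degenerates as `γ' → 0`.

* `witness_rotation_law` — `Ψ(R_s y) = cos s·Ψ(y) + sin s·Ψ̃(y)` (substitution `t ↦ t − s` + periodicity; `Ψ̃` the sine companion);
  `witness_angular` — the angular relation `ΘΘΨ = −Ψ` via part I's orbit formula `d²/ds² Ψ(R_s y) = ΘΘΨ(R_s y)` and the rotation law;
* `witness_divergence` — the Helmholtz relation `Σᵢ ∂ᵢ(c²∂ᵢΨ) = −c²k²Ψ` from the second-derivative integral (`cos² + sin² = 1`);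
* `witness_not_const` — `DΨ(0)[e₁] = k∫₀^{2π} sin² = kπ ≠ 0`;
* `witness_angularDeriv_not_zero` (`ΘΨ ≢ 0`), `witness_fderiv_abs_le`, `witness_fderiv_fderiv_apply`, `witness_fderiv_fderiv_abs_le`
  (uniform bounds of `DΨ`, `D²Ψ`);
* ★ `rotating_const_false_without_thick` — the same packaged against the exact hypothesis list of the would-be lemma `rotating_const`
  (evidence #47 §3): every hypothesis but the thick clause holds (`γ ≡ c²`, `γ' ≡ 0` is one-signed both ways), the conclusion `ΘΨ ≡ 0` fails;
* ★ `rotating_linear_witness` — **the witness**: for `ω ≠ 0`, `c ≠ 0` there is `Ψ : ℝ² → ℝ` with `ContDiff ℝ 2 Ψ`, `|Ψ| ≤ 2π`,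
  `ω² ΘΘΨ = Σᵢ ∂ᵢ(c²∂ᵢΨ)` everywhere (the hypothesis `hrot` of parts I–VI with `γ ≡ c²`: `0 < γlo = γ = γhi`, but `γ' ≡ 0` — exactly the
  THICK clause fails), and `Ψ` not constant.

Elementary analysis; no rigidity is proved (an inhabitant is exhibited for the degenerate case).  presearch: classical Bessel mode `J₁(kr)e^{iθ}`
of the reduced wave equation (Watson, *Bessel Functions* §2.2); nothing to cite beyond folklore. [folklore]
-/

noncomputable section

namespace Summit.NavierStokesRegularity.NavierStokesRegularity.Theorems.PoloidalWindowDoorPoloidalWindowRigidityZShockRotatingProfileLinearWitness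

-- the summit and its single sub-problem share the name (CONVENTIONS §1)
set_option linter.dupNamespace false

open Set Filter Topology Function MeasureTheory intervalIntegral
open Summit.NavierStokesRegularity.NavierStokesRegularity.Theorems.PoloidalWindowDoorPoloidalWindowRigidityZShockRotatingProfile PoloidalWindowDoorPoloidalWindowRigidityZShockRotatingProfileLinearWitnessCalculus

variable {J : EuclideanSpace ℝ (Fin 2) → EuclideanSpace ℝ (Fin 2)} {L : ℝ → EuclideanSpace ℝ (Fin 2) →L[ℝ] ℝ} {k : ℝ}

/-- **The rotation law** `Ψ(R_s y) = cos s·Ψ(y) + sin s·Ψ̃(y)`, `Ψ̃` the sine companion (substitution `t ↦ t − s` and periodicity).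
[folklore] -/
theorem witness_rotation_law {Ψ : EuclideanSpace ℝ (Fin 2) → ℝ}
    (hΨ : ∀ y, Ψ y = ∫ t in (0 : ℝ)..2 * Real.pi, Real.cos (k * (y 0 * Real.cos t + y 1 * Real.sin t) - t)) (y : EuclideanSpace ℝ (Fin 2)) (s : ℝ) :
    Ψ ((Real.cos s * y 0 - Real.sin s * y 1) • EuclideanSpace.single (0 : Fin 2) (1 : ℝ) +
        (Real.sin s * y 0 + Real.cos s * y 1) • EuclideanSpace.single (1 : Fin 2) (1 : ℝ)) =
      Real.cos s * Ψ y + Real.sin s * ∫ t in (0 : ℝ)..2 * Real.pi, Real.sin (k * (y 0 * Real.cos t + y 1 * Real.sin t) - t) := by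
  have hFy : Continuous fun t => Real.cos (k * (y 0 * Real.cos t + y 1 * Real.sin t) - t) :=
    continuous_planeWave_at k y
  have hGy : Continuous fun t => Real.sin (k * (y 0 * Real.cos t + y 1 * Real.sin t) - t) :=
    continuous_planeWaveSin_at k y
  have h1 : Ψ ((Real.cos s * y 0 - Real.sin s * y 1) • EuclideanSpace.single (0 : Fin 2) (1 : ℝ) +
        (Real.sin s * y 0 + Real.cos s * y 1) • EuclideanSpace.single (1 : Fin 2) (1 : ℝ)) =
      ∫ t in (0 : ℝ)..2 * Real.pi, Real.cos (k * (y 0 * Real.cos (t - s) + y 1 * Real.sin (t - s)) - (t - s) - s) := by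
    rw [hΨ]
    refine intervalIntegral.integral_congr fun t _ => ?_
    have h0 : ((Real.cos s * y 0 - Real.sin s * y 1) • EuclideanSpace.single (0 : Fin 2) (1 : ℝ) +
        (Real.sin s * y 0 + Real.cos s * y 1) • EuclideanSpace.single (1 : Fin 2) (1 : ℝ)) 0 = Real.cos s * y 0 - Real.sin s * y 1 := by
      simp
    have h1' : ((Real.cos s * y 0 - Real.sin s * y 1) • EuclideanSpace.single (0 : Fin 2) (1 : ℝ) +
        (Real.sin s * y 0 + Real.cos s * y 1) • EuclideanSpace.single (1 : Fin 2) (1 : ℝ)) 1 = Real.sin s * y 0 + Real.cos s * y 1 := by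
      simp
    simp only
    rw [h0, h1', rotated_phase]
    ring_nf
  have hper : Function.Periodic (fun τ => Real.cos (k * (y 0 * Real.cos τ + y 1 * Real.sin τ) - τ - s)) (2 * Real.pi) := by
    intro τ
    simp only
    rw [Real.cos_add_two_pi, Real.sin_add_two_pi, show k * (y 0 * Real.cos τ + y 1 * Real.sin τ) - (τ + 2 * Real.pi) - s =
      (k * (y 0 * Real.cos τ + y 1 * Real.sin τ) - τ - s) - 2 * Real.pi by ring, Real.cos_sub_two_pi]
  have h2 : (∫ t in (0 : ℝ)..2 * Real.pi, Real.cos (k * (y 0 * Real.cos (t - s) + y 1 * Real.sin (t - s)) - (t - s) - s)) =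
      ∫ τ in (0 : ℝ)..2 * Real.pi, Real.cos (k * (y 0 * Real.cos τ + y 1 * Real.sin τ) - τ - s) := by
    rw [intervalIntegral.integral_comp_sub_right (fun τ => Real.cos (k * (y 0 * Real.cos τ + y 1 * Real.sin τ) - τ - s)) s,
      zero_sub, show 2 * Real.pi - s = -s + 2 * Real.pi by ring, hper.intervalIntegral_add_eq (-s) 0, zero_add]
  have h3 : (fun τ => Real.cos (k * (y 0 * Real.cos τ + y 1 * Real.sin τ) - τ - s)) =
      fun τ => Real.cos s * Real.cos (k * (y 0 * Real.cos τ + y 1 * Real.sin τ) - τ) +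
        Real.sin s * Real.sin (k * (y 0 * Real.cos τ + y 1 * Real.sin τ) - τ) := by
    funext τ; rw [Real.cos_sub]; ring
  have hi1 : IntervalIntegrable (fun τ => Real.cos s * Real.cos (k * (y 0 * Real.cos τ + y 1 * Real.sin τ) - τ))
      volume (0 : ℝ) (2 * Real.pi) := (continuous_const.mul hFy).intervalIntegrable _ _
  have hi2 : IntervalIntegrable (fun τ => Real.sin s * Real.sin (k * (y 0 * Real.cos τ + y 1 * Real.sin τ) - τ))
      volume (0 : ℝ) (2 * Real.pi) := (continuous_const.mul hGy).intervalIntegrable _ _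
  rw [h1, h2, h3, intervalIntegral.integral_add hi1 hi2, intervalIntegral.integral_const_mul,
    intervalIntegral.integral_const_mul, ← hΨ]

/-- **The angular relation `ΘΘΨ = −Ψ`** (part I's orbit formula + the rotation law). [folklore] -/
theorem witness_angular {Ψ : EuclideanSpace ℝ (Fin 2) → ℝ} {Ψ' : EuclideanSpace ℝ (Fin 2) → EuclideanSpace ℝ (Fin 2) →L[ℝ] ℝ}
    {Ψ'' : EuclideanSpace ℝ (Fin 2) → EuclideanSpace ℝ (Fin 2) →L[ℝ] (EuclideanSpace ℝ (Fin 2) →L[ℝ] ℝ)}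
    (hJ : ∀ y' : EuclideanSpace ℝ (Fin 2), J y' = (-(y' 1)) • EuclideanSpace.single (0 : Fin 2) (1 : ℝ) +
      (y' 0) • EuclideanSpace.single (1 : Fin 2) (1 : ℝ))
    (hL : ∀ t, L t = Real.cos t • (EuclideanSpace.proj (𝕜 := ℝ) (0 : Fin 2) : EuclideanSpace ℝ (Fin 2) →L[ℝ] ℝ) +
      Real.sin t • (EuclideanSpace.proj (𝕜 := ℝ) (1 : Fin 2) : EuclideanSpace ℝ (Fin 2) →L[ℝ] ℝ))
    (hΨ : ∀ y, Ψ y = ∫ t in (0 : ℝ)..2 * Real.pi, Real.cos (k * (y 0 * Real.cos t + y 1 * Real.sin t) - t))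
    (hΨ' : ∀ y, Ψ' y = ∫ t in (0 : ℝ)..2 * Real.pi, (-Real.sin (k * (y 0 * Real.cos t + y 1 * Real.sin t) - t)) • (k • L t))
    (hΨ'' : ∀ y, Ψ'' y = ∫ t in (0 : ℝ)..2 * Real.pi,
      (-(Real.cos (k * (y 0 * Real.cos t + y 1 * Real.sin t) - t) • (k • L t))).smulRight (k • L t))
    (y : EuclideanSpace ℝ (Fin 2)) : fderiv ℝ (fun y' => fderiv ℝ Ψ y' (J y')) y (J y) = -Ψ y := by
  have hΨ2 := witness_contDiff hL hΨ hΨ' hΨ''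
  set cy : ℝ → EuclideanSpace ℝ (Fin 2) := fun s => (Real.cos (1 * s) * y 0 - Real.sin (1 * s) * y 1) •
      EuclideanSpace.single (0 : Fin 2) (1 : ℝ) +
    (Real.sin (1 * s) * y 0 + Real.cos (1 * s) * y 1) • EuclideanSpace.single (1 : Fin 2) (1 : ℝ) with hcy_def
  have hcy : ∀ s, cy s = (Real.cos (1 * s) * y 0 - Real.sin (1 * s) * y 1) • EuclideanSpace.single (0 : Fin 2) (1 : ℝ) +
      (Real.sin (1 * s) * y 0 + Real.cos (1 * s) * y 1) • EuclideanSpace.single (1 : Fin 2) (1 : ℝ) := fun s => rfl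
  have horbit := deriv_deriv_comp_rotOrbit hΨ2 hcy hJ 0
  rw [rotOrbit_zero hcy, one_pow, one_mul] at horbit
  set A : ℝ := Ψ y with hA
  set B : ℝ := ∫ t in (0 : ℝ)..2 * Real.pi, Real.sin (k * (y 0 * Real.cos t + y 1 * Real.sin t) - t) with hB
  have hfun1 : (fun s'' => Ψ (cy s'')) = fun s'' => Real.cos s'' * A + Real.sin s'' * B := by
    funext s''
    rw [hcy, one_mul]
    exact witness_rotation_law hΨ y s''
  have hder1 : ∀ s, HasDerivAt (fun s'' => Real.cos s'' * A + Real.sin s'' * B) (-Real.sin s * A + Real.cos s * B) s := fun s =>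
    ((Real.hasDerivAt_cos s).mul_const A).add ((Real.hasDerivAt_sin s).mul_const B)
  have hfun2 : deriv (fun s'' => Real.cos s'' * A + Real.sin s'' * B) = fun s => -Real.sin s * A + Real.cos s * B :=
    funext fun s => (hder1 s).deriv
  have hder2 : HasDerivAt (fun s => -Real.sin s * A + Real.cos s * B) (-Real.cos 0 * A + -Real.sin 0 * B) 0 :=
    ((Real.hasDerivAt_sin 0).neg.mul_const A).add ((Real.hasDerivAt_cos 0).mul_const B)
  rw [← horbit, hfun1, hfun2, hder2.deriv, Real.cos_zero, Real.sin_zero]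
  ring

/-- **The Helmholtz relation `Σᵢ ∂ᵢ(c² ∂ᵢΨ) = −c²k² Ψ`** (second derivatives under the integral; `cos² + sin² = 1`). [folklore] -/
theorem witness_divergence {Ψ : EuclideanSpace ℝ (Fin 2) → ℝ} {Ψ' : EuclideanSpace ℝ (Fin 2) → EuclideanSpace ℝ (Fin 2) →L[ℝ] ℝ}
    {Ψ'' : EuclideanSpace ℝ (Fin 2) → EuclideanSpace ℝ (Fin 2) →L[ℝ] (EuclideanSpace ℝ (Fin 2) →L[ℝ] ℝ)}
    (hL : ∀ t, L t = Real.cos t • (EuclideanSpace.proj (𝕜 := ℝ) (0 : Fin 2) : EuclideanSpace ℝ (Fin 2) →L[ℝ] ℝ) +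
      Real.sin t • (EuclideanSpace.proj (𝕜 := ℝ) (1 : Fin 2) : EuclideanSpace ℝ (Fin 2) →L[ℝ] ℝ))
    (hΨ : ∀ y, Ψ y = ∫ t in (0 : ℝ)..2 * Real.pi, Real.cos (k * (y 0 * Real.cos t + y 1 * Real.sin t) - t))
    (hΨ' : ∀ y, Ψ' y = ∫ t in (0 : ℝ)..2 * Real.pi, (-Real.sin (k * (y 0 * Real.cos t + y 1 * Real.sin t) - t)) • (k • L t))
    (hΨ'' : ∀ y, Ψ'' y = ∫ t in (0 : ℝ)..2 * Real.pi,
      (-(Real.cos (k * (y 0 * Real.cos t + y 1 * Real.sin t) - t) • (k • L t))).smulRight (k • L t))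
    (c : ℝ) (y : EuclideanSpace ℝ (Fin 2)) :
    ∑ i, fderiv ℝ (fun y' => c ^ 2 * fderiv ℝ Ψ y' (EuclideanSpace.single i 1)) y (EuclideanSpace.single i 1) =
      -(c ^ 2 * k ^ 2) * Ψ y := by
  have hΨd := witness_hasFDerivAt hL hΨ hΨ'
  have hΨ'd := witness_deriv_hasFDerivAt hL hΨ' hΨ''
  have hF''y : Continuous fun t => (-(Real.cos (k * (y 0 * Real.cos t + y 1 * Real.sin t) - t) • (k • L t))).smulRight (k • L t) :=
    continuous_planeWave_deriv2_at hL k y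
  have hFy : Continuous fun t => Real.cos (k * (y 0 * Real.cos t + y 1 * Real.sin t) - t) :=
    continuous_planeWave_at k y
  have hL0 : ∀ t, L t (EuclideanSpace.single 0 1) = Real.cos t := fun t => by rw [radialForm_apply hL]; simp
  have hL1 : ∀ t, L t (EuclideanSpace.single 1 1) = Real.sin t := fun t => by rw [radialForm_apply hL]; simp
  have hsecond : ∀ i : Fin 2, fderiv ℝ (fun y' => c ^ 2 * fderiv ℝ Ψ y' (EuclideanSpace.single i 1)) y (EuclideanSpace.single i 1) =
      c ^ 2 * ∫ t in (0 : ℝ)..2 * Real.pi,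
        (-(Real.cos (k * (y 0 * Real.cos t + y 1 * Real.sin t) - t) • (k • L t))).smulRight (k • L t)
          (EuclideanSpace.single i 1) (EuclideanSpace.single i 1) := by
    intro i
    have hf : (fun y' => c ^ 2 * fderiv ℝ Ψ y' (EuclideanSpace.single i 1)) = fun y' => c ^ 2 * Ψ' y' (EuclideanSpace.single i 1) := by
      funext y'; rw [(hΨd y').fderiv]
    have hd : HasFDerivAt (fun y' => c ^ 2 * Ψ' y' (EuclideanSpace.single i 1))
        (c ^ 2 • ((Ψ' y).comp (0 : EuclideanSpace ℝ (Fin 2) →L[ℝ] EuclideanSpace ℝ (Fin 2)) +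
          (Ψ'' y).flip (EuclideanSpace.single i 1))) y :=
      ((hΨ'd y).clm_apply (hasFDerivAt_const (EuclideanSpace.single i 1) y)).const_mul (c ^ 2)
    rw [hf, hd.fderiv]
    simp only [smul_apply, add_apply, ContinuousLinearMap.comp_apply, _root_.zero_apply, map_zero, zero_add,
      ContinuousLinearMap.flip_apply, smul_eq_mul]
    rw [hΨ'', ContinuousLinearMap.intervalIntegral_apply (hF''y.intervalIntegrable _ _),
      ContinuousLinearMap.intervalIntegral_apply ((hF''y.clm_apply continuous_const).intervalIntegrable _ _)]
  have happly : ∀ t (h h' : EuclideanSpace ℝ (Fin 2)),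
      (-(Real.cos (k * (y 0 * Real.cos t + y 1 * Real.sin t) - t) • (k • L t))).smulRight (k • L t) h h' =
        -(Real.cos (k * (y 0 * Real.cos t + y 1 * Real.sin t) - t) * (k * L t h)) * (k * L t h') := by
    intro t h h'
    simp only [ContinuousLinearMap.smulRight_apply, neg_apply, smul_apply, smul_eq_mul, neg_mul]
  rw [Fin.sum_univ_two, hsecond 0, hsecond 1]
  simp only [happly, hL0, hL1]
  have hi0 : IntervalIntegrable (fun t => -(Real.cos (k * (y 0 * Real.cos t + y 1 * Real.sin t) - t) * (k * Real.cos t)) *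
      (k * Real.cos t)) volume (0 : ℝ) (2 * Real.pi) :=
    (((hFy.mul (continuous_const.mul Real.continuous_cos)).neg).mul (continuous_const.mul Real.continuous_cos)).intervalIntegrable _ _
  have hi1 : IntervalIntegrable (fun t => -(Real.cos (k * (y 0 * Real.cos t + y 1 * Real.sin t) - t) * (k * Real.sin t)) *
      (k * Real.sin t)) volume (0 : ℝ) (2 * Real.pi) :=
    (((hFy.mul (continuous_const.mul Real.continuous_sin)).neg).mul (continuous_const.mul Real.continuous_sin)).intervalIntegrable _ _
  rw [← mul_add, ← intervalIntegral.integral_add hi0 hi1]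
  have hint : (fun t => -(Real.cos (k * (y 0 * Real.cos t + y 1 * Real.sin t) - t) * (k * Real.cos t)) * (k * Real.cos t) +
      -(Real.cos (k * (y 0 * Real.cos t + y 1 * Real.sin t) - t) * (k * Real.sin t)) * (k * Real.sin t)) =
      fun t => -(k ^ 2) * Real.cos (k * (y 0 * Real.cos t + y 1 * Real.sin t) - t) := by
    funext t
    have hcs := Real.cos_sq_add_sin_sq t
    linear_combination (-(k ^ 2) * Real.cos (k * (y 0 * Real.cos t + y 1 * Real.sin t) - t)) * hcs
  rw [hint, intervalIntegral.integral_const_mul, ← hΨ]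
  ring

/-- **`Ψ` is not constant**: `DΨ(0)[e₁] = k ∫₀^{2π} sin² = kπ ≠ 0`. [folklore] -/
theorem witness_not_const {Ψ : EuclideanSpace ℝ (Fin 2) → ℝ} {Ψ' : EuclideanSpace ℝ (Fin 2) → EuclideanSpace ℝ (Fin 2) →L[ℝ] ℝ}
    (hL : ∀ t, L t = Real.cos t • (EuclideanSpace.proj (𝕜 := ℝ) (0 : Fin 2) : EuclideanSpace ℝ (Fin 2) →L[ℝ] ℝ) +
      Real.sin t • (EuclideanSpace.proj (𝕜 := ℝ) (1 : Fin 2) : EuclideanSpace ℝ (Fin 2) →L[ℝ] ℝ))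
    (hΨ : ∀ y, Ψ y = ∫ t in (0 : ℝ)..2 * Real.pi, Real.cos (k * (y 0 * Real.cos t + y 1 * Real.sin t) - t))
    (hΨ' : ∀ y, Ψ' y = ∫ t in (0 : ℝ)..2 * Real.pi, (-Real.sin (k * (y 0 * Real.cos t + y 1 * Real.sin t) - t)) • (k • L t))
    (hk : k ≠ 0) : ¬ ∀ y y' : EuclideanSpace ℝ (Fin 2), Ψ y = Ψ y' := by
  intro hconst
  have hΨd := witness_hasFDerivAt hL hΨ hΨ'
  have hΨc : Ψ = fun _ => Ψ 0 := funext fun y => hconst y 0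
  have h0 : HasFDerivAt Ψ (0 : EuclideanSpace ℝ (Fin 2) →L[ℝ] ℝ) 0 := by
    rw [hΨc]; exact hasFDerivAt_const _ _
  have hzero : Ψ' 0 = 0 := (hΨd 0).unique h0
  have hF'c : Continuous fun t => (-Real.sin (k * ((0 : EuclideanSpace ℝ (Fin 2)) 0 * Real.cos t +
      (0 : EuclideanSpace ℝ (Fin 2)) 1 * Real.sin t) - t)) • (k • L t) :=
    continuous_planeWave_deriv_at hL k 0
  have happ : Ψ' 0 (EuclideanSpace.single 1 1) = k * Real.pi := by
    rw [hΨ', ContinuousLinearMap.intervalIntegral_apply (hF'c.intervalIntegrable _ _)]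
    have hf : (fun t => ((-Real.sin (k * ((0 : EuclideanSpace ℝ (Fin 2)) 0 * Real.cos t +
        (0 : EuclideanSpace ℝ (Fin 2)) 1 * Real.sin t) - t)) • (k • L t)) (EuclideanSpace.single 1 1)) = fun t => k * Real.sin t ^ 2 := by
      funext t
      simp only [smul_apply, smul_eq_mul, radialForm_apply hL]
      simp [Real.sin_neg]
      ring
    rw [hf, intervalIntegral.integral_const_mul, integral_sin_sq, Real.sin_zero, Real.cos_zero, Real.sin_two_pi]
    ring
  rw [hzero, _root_.zero_apply] at happ
  exact mul_ne_zero hk Real.pi_ne_zero happ.symm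

/-- **`Ψ` is not radial**: the angular derivative `ΘΨ = DΨ(·)[J·]` does not vanish identically (else `ΘΘΨ ≡ 0`, so `Ψ ≡ 0` by the
angular relation, contradicting non-constancy). [folklore] -/
theorem witness_angularDeriv_not_zero {Ψ : EuclideanSpace ℝ (Fin 2) → ℝ} {Ψ' : EuclideanSpace ℝ (Fin 2) → EuclideanSpace ℝ (Fin 2) →L[ℝ] ℝ}
    {Ψ'' : EuclideanSpace ℝ (Fin 2) → EuclideanSpace ℝ (Fin 2) →L[ℝ] (EuclideanSpace ℝ (Fin 2) →L[ℝ] ℝ)}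
    (hJ : ∀ y' : EuclideanSpace ℝ (Fin 2), J y' = (-(y' 1)) • EuclideanSpace.single (0 : Fin 2) (1 : ℝ) +
      (y' 0) • EuclideanSpace.single (1 : Fin 2) (1 : ℝ))
    (hL : ∀ t, L t = Real.cos t • (EuclideanSpace.proj (𝕜 := ℝ) (0 : Fin 2) : EuclideanSpace ℝ (Fin 2) →L[ℝ] ℝ) +
      Real.sin t • (EuclideanSpace.proj (𝕜 := ℝ) (1 : Fin 2) : EuclideanSpace ℝ (Fin 2) →L[ℝ] ℝ))
    (hΨ : ∀ y, Ψ y = ∫ t in (0 : ℝ)..2 * Real.pi, Real.cos (k * (y 0 * Real.cos t + y 1 * Real.sin t) - t))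
    (hΨ' : ∀ y, Ψ' y = ∫ t in (0 : ℝ)..2 * Real.pi, (-Real.sin (k * (y 0 * Real.cos t + y 1 * Real.sin t) - t)) • (k • L t))
    (hΨ'' : ∀ y, Ψ'' y = ∫ t in (0 : ℝ)..2 * Real.pi,
      (-(Real.cos (k * (y 0 * Real.cos t + y 1 * Real.sin t) - t) • (k • L t))).smulRight (k • L t))
    (hk : k ≠ 0) : ¬ ∀ y : EuclideanSpace ℝ (Fin 2), fderiv ℝ Ψ y (J y) = 0 := by
  intro h0
  apply witness_not_const hL hΨ hΨ' hk
  have hz : ∀ z, Ψ z = 0 := fun z => by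
    have ha := witness_angular hJ hL hΨ hΨ' hΨ'' z
    have hfun : (fun y' => fderiv ℝ Ψ y' (J y')) = fun _ => (0 : ℝ) := funext h0
    rw [hfun, (hasFDerivAt_const (0 : ℝ) z).fderiv, _root_.zero_apply] at ha
    linarith
  intro y y'
  rw [hz y, hz y']

/-- **First-derivative bound**: `|DΨ(y)[h]| ≤ 2π·|k|(‖pr₀‖ + ‖pr₁‖)·‖h‖`. [folklore] -/
theorem witness_fderiv_abs_le {Ψ : EuclideanSpace ℝ (Fin 2) → ℝ} {Ψ' : EuclideanSpace ℝ (Fin 2) → EuclideanSpace ℝ (Fin 2) →L[ℝ] ℝ}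
    (hL : ∀ t, L t = Real.cos t • (EuclideanSpace.proj (𝕜 := ℝ) (0 : Fin 2) : EuclideanSpace ℝ (Fin 2) →L[ℝ] ℝ) +
      Real.sin t • (EuclideanSpace.proj (𝕜 := ℝ) (1 : Fin 2) : EuclideanSpace ℝ (Fin 2) →L[ℝ] ℝ))
    (hΨ : ∀ y, Ψ y = ∫ t in (0 : ℝ)..2 * Real.pi, Real.cos (k * (y 0 * Real.cos t + y 1 * Real.sin t) - t))
    (hΨ' : ∀ y, Ψ' y = ∫ t in (0 : ℝ)..2 * Real.pi, (-Real.sin (k * (y 0 * Real.cos t + y 1 * Real.sin t) - t)) • (k • L t))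
    (y h : EuclideanSpace ℝ (Fin 2)) :
    |fderiv ℝ Ψ y h| ≤ 2 * Real.pi * (|k| * (‖(EuclideanSpace.proj (𝕜 := ℝ) (0 : Fin 2) : EuclideanSpace ℝ (Fin 2) →L[ℝ] ℝ)‖ +
      ‖(EuclideanSpace.proj (𝕜 := ℝ) (1 : Fin 2) : EuclideanSpace ℝ (Fin 2) →L[ℝ] ℝ)‖)) * ‖h‖ := by
  have hnorm : ‖Ψ' y‖ ≤ 2 * Real.pi * (|k| * (‖(EuclideanSpace.proj (𝕜 := ℝ) (0 : Fin 2) : EuclideanSpace ℝ (Fin 2) →L[ℝ] ℝ)‖ +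
      ‖(EuclideanSpace.proj (𝕜 := ℝ) (1 : Fin 2) : EuclideanSpace ℝ (Fin 2) →L[ℝ] ℝ)‖)) := by
    have hb := intervalIntegral.norm_integral_le_of_norm_le_const (a := (0 : ℝ)) (b := 2 * Real.pi)
      (C := |k| * (‖(EuclideanSpace.proj (𝕜 := ℝ) (0 : Fin 2) : EuclideanSpace ℝ (Fin 2) →L[ℝ] ℝ)‖ +
        ‖(EuclideanSpace.proj (𝕜 := ℝ) (1 : Fin 2) : EuclideanSpace ℝ (Fin 2) →L[ℝ] ℝ)‖))
      (f := fun t => (-Real.sin (k * (y 0 * Real.cos t + y 1 * Real.sin t) - t)) • (k • L t))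
      fun t _ => norm_planeWave_deriv_le hL k t y
    rw [sub_zero, abs_of_pos Real.two_pi_pos, ← hΨ'] at hb
    linarith
  rw [(witness_hasFDerivAt hL hΨ hΨ' y).fderiv]
  have happ := (Ψ' y).le_of_opNorm_le hnorm h
  rw [Real.norm_eq_abs] at happ
  exact happ

/-- **Second-derivative formula**: `D(DΨ(·)[h])(y)[h'] = Ψ''(y) h' h`. [folklore] -/
theorem witness_fderiv_fderiv_apply {Ψ : EuclideanSpace ℝ (Fin 2) → ℝ} {Ψ' : EuclideanSpace ℝ (Fin 2) → EuclideanSpace ℝ (Fin 2) →L[ℝ] ℝ}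
    {Ψ'' : EuclideanSpace ℝ (Fin 2) → EuclideanSpace ℝ (Fin 2) →L[ℝ] (EuclideanSpace ℝ (Fin 2) →L[ℝ] ℝ)}
    (hL : ∀ t, L t = Real.cos t • (EuclideanSpace.proj (𝕜 := ℝ) (0 : Fin 2) : EuclideanSpace ℝ (Fin 2) →L[ℝ] ℝ) +
      Real.sin t • (EuclideanSpace.proj (𝕜 := ℝ) (1 : Fin 2) : EuclideanSpace ℝ (Fin 2) →L[ℝ] ℝ))
    (hΨ : ∀ y, Ψ y = ∫ t in (0 : ℝ)..2 * Real.pi, Real.cos (k * (y 0 * Real.cos t + y 1 * Real.sin t) - t))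
    (hΨ' : ∀ y, Ψ' y = ∫ t in (0 : ℝ)..2 * Real.pi, (-Real.sin (k * (y 0 * Real.cos t + y 1 * Real.sin t) - t)) • (k • L t))
    (hΨ'' : ∀ y, Ψ'' y = ∫ t in (0 : ℝ)..2 * Real.pi,
      (-(Real.cos (k * (y 0 * Real.cos t + y 1 * Real.sin t) - t) • (k • L t))).smulRight (k • L t))
    (y h h' : EuclideanSpace ℝ (Fin 2)) :
    fderiv ℝ (fun y' => fderiv ℝ Ψ y' h) y h' = Ψ'' y h' h := by
  have hΨd := witness_hasFDerivAt hL hΨ hΨ'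
  have hΨ'd := witness_deriv_hasFDerivAt hL hΨ' hΨ''
  have hf : (fun y' => fderiv ℝ Ψ y' h) = fun y' => Ψ' y' h := by
    funext y'; rw [(hΨd y').fderiv]
  rw [hf, ((hΨ'd y).clm_apply (hasFDerivAt_const h y)).fderiv]
  simp only [add_apply, ContinuousLinearMap.comp_apply, _root_.zero_apply, map_zero, zero_add,
    ContinuousLinearMap.flip_apply]

/-- **Second-derivative bound**: `|D(DΨ(·)[h])(y)[h']| ≤ 2π·(|k|(‖pr₀‖ + ‖pr₁‖))²·‖h‖·‖h'‖`. [folklore] -/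
theorem witness_fderiv_fderiv_abs_le {Ψ : EuclideanSpace ℝ (Fin 2) → ℝ} {Ψ' : EuclideanSpace ℝ (Fin 2) → EuclideanSpace ℝ (Fin 2) →L[ℝ] ℝ}
    {Ψ'' : EuclideanSpace ℝ (Fin 2) → EuclideanSpace ℝ (Fin 2) →L[ℝ] (EuclideanSpace ℝ (Fin 2) →L[ℝ] ℝ)}
    (hL : ∀ t, L t = Real.cos t • (EuclideanSpace.proj (𝕜 := ℝ) (0 : Fin 2) : EuclideanSpace ℝ (Fin 2) →L[ℝ] ℝ) +
      Real.sin t • (EuclideanSpace.proj (𝕜 := ℝ) (1 : Fin 2) : EuclideanSpace ℝ (Fin 2) →L[ℝ] ℝ))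
    (hΨ : ∀ y, Ψ y = ∫ t in (0 : ℝ)..2 * Real.pi, Real.cos (k * (y 0 * Real.cos t + y 1 * Real.sin t) - t))
    (hΨ' : ∀ y, Ψ' y = ∫ t in (0 : ℝ)..2 * Real.pi, (-Real.sin (k * (y 0 * Real.cos t + y 1 * Real.sin t) - t)) • (k • L t))
    (hΨ'' : ∀ y, Ψ'' y = ∫ t in (0 : ℝ)..2 * Real.pi,
      (-(Real.cos (k * (y 0 * Real.cos t + y 1 * Real.sin t) - t) • (k • L t))).smulRight (k • L t))
    (y h h' : EuclideanSpace ℝ (Fin 2)) :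
    |fderiv ℝ (fun y' => fderiv ℝ Ψ y' h) y h'| ≤
      2 * Real.pi * ((|k| * (‖(EuclideanSpace.proj (𝕜 := ℝ) (0 : Fin 2) : EuclideanSpace ℝ (Fin 2) →L[ℝ] ℝ)‖ +
        ‖(EuclideanSpace.proj (𝕜 := ℝ) (1 : Fin 2) : EuclideanSpace ℝ (Fin 2) →L[ℝ] ℝ)‖)) *
        (|k| * (‖(EuclideanSpace.proj (𝕜 := ℝ) (0 : Fin 2) : EuclideanSpace ℝ (Fin 2) →L[ℝ] ℝ)‖ +
        ‖(EuclideanSpace.proj (𝕜 := ℝ) (1 : Fin 2) : EuclideanSpace ℝ (Fin 2) →L[ℝ] ℝ)‖))) * ‖h‖ * ‖h'‖ := by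
  set C : ℝ := |k| * (‖(EuclideanSpace.proj (𝕜 := ℝ) (0 : Fin 2) : EuclideanSpace ℝ (Fin 2) →L[ℝ] ℝ)‖ +
    ‖(EuclideanSpace.proj (𝕜 := ℝ) (1 : Fin 2) : EuclideanSpace ℝ (Fin 2) →L[ℝ] ℝ)‖) with hC
  have hnorm : ‖Ψ'' y‖ ≤ 2 * Real.pi * (C * C) := by
    have hb := intervalIntegral.norm_integral_le_of_norm_le_const (a := (0 : ℝ)) (b := 2 * Real.pi) (C := C * C)
      (f := fun t => (-(Real.cos (k * (y 0 * Real.cos t + y 1 * Real.sin t) - t) • (k • L t))).smulRight (k • L t))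
      fun t _ => norm_planeWave_deriv2_le hL k t y
    rw [sub_zero, abs_of_pos Real.two_pi_pos, ← hΨ''] at hb
    linarith
  rw [witness_fderiv_fderiv_apply hL hΨ hΨ' hΨ'' y h h']
  have h1 : ‖Ψ'' y h'‖ ≤ 2 * Real.pi * (C * C) * ‖h'‖ := (Ψ'' y).le_of_opNorm_le hnorm h'
  have h2 : ‖Ψ'' y h' h‖ ≤ 2 * Real.pi * (C * C) * ‖h'‖ * ‖h‖ := (Ψ'' y h').le_of_opNorm_le h1 h
  rw [Real.norm_eq_abs] at h2
  calc |Ψ'' y h' h| ≤ 2 * Real.pi * (C * C) * ‖h'‖ * ‖h‖ := h2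
    _ = 2 * Real.pi * (C * C) * ‖h‖ * ‖h'‖ := by ring

/-! ### The tightness statement -/

/-- ★ **TIGHTNESS: the linearly degenerate rotating-pattern equation is inhabited.**  For every rotation rate `ω ≠ 0` and speed `c ≠ 0`
there is a profile `Ψ : ℝ² → ℝ` with `ContDiff ℝ 2 Ψ`, `|Ψ| ≤ 2π`, solving `ω² ΘΘΨ = Σᵢ ∂ᵢ(c² ∂ᵢΨ)` on the whole plane (the hypothesis `hrot`
of parts I–VI with the CONSTANT squared speed `γ ≡ c²`, i.e. `0 < γlo = γ = γhi` but `γ' ≡ 0`: exactly the THICK clause fails), and NOT constant: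
`Ψ(y) = ∫₀^{2π} cos(k(y₀ cos t + y₁ sin t) − t) dt`, `k = ω/c` (a Bessel spiral mode).  Hence the thickness (genuine nonlinearity) hypothesis of
the rotating-rigidity item is load-bearing. [folklore] -/
theorem rotating_linear_witness {ω c : ℝ} (hω : ω ≠ 0) (hc : c ≠ 0)
    (hJ : ∀ y' : EuclideanSpace ℝ (Fin 2), J y' = (-(y' 1)) • EuclideanSpace.single (0 : Fin 2) (1 : ℝ) +
      (y' 0) • EuclideanSpace.single (1 : Fin 2) (1 : ℝ)) :
    ∃ Ψ : EuclideanSpace ℝ (Fin 2) → ℝ, ContDiff ℝ 2 Ψ ∧ (∀ y, |Ψ y| ≤ 2 * Real.pi) ∧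
      (∀ y : EuclideanSpace ℝ (Fin 2),
        ω ^ 2 * fderiv ℝ (fun y' => fderiv ℝ Ψ y' (J y')) y (J y) =
          ∑ i, fderiv ℝ (fun y' => c ^ 2 * fderiv ℝ Ψ y' (EuclideanSpace.single i 1)) y (EuclideanSpace.single i 1)) ∧
      ¬ (∀ y y' : EuclideanSpace ℝ (Fin 2), Ψ y = Ψ y') := by
  have hk : ω / c ≠ 0 := div_ne_zero hω hc
  have hck : c ^ 2 * (ω / c) ^ 2 = ω ^ 2 := by field_simp
  have hL : ∀ t, (fun t => Real.cos t • (EuclideanSpace.proj (𝕜 := ℝ) (0 : Fin 2) : EuclideanSpace ℝ (Fin 2) →L[ℝ] ℝ) +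
      Real.sin t • (EuclideanSpace.proj (𝕜 := ℝ) (1 : Fin 2) : EuclideanSpace ℝ (Fin 2) →L[ℝ] ℝ)) t = Real.cos t • (EuclideanSpace.proj (𝕜 := ℝ) (0 : Fin 2) : EuclideanSpace ℝ (Fin 2) →L[ℝ] ℝ) +
      Real.sin t • (EuclideanSpace.proj (𝕜 := ℝ) (1 : Fin 2) : EuclideanSpace ℝ (Fin 2) →L[ℝ] ℝ) := fun t => rfl
  have hΨ : ∀ y, (fun y : EuclideanSpace ℝ (Fin 2) => ∫ t in (0 : ℝ)..2 * Real.pi,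
      Real.cos (ω / c * (y 0 * Real.cos t + y 1 * Real.sin t) - t)) y =
      ∫ t in (0 : ℝ)..2 * Real.pi, Real.cos (ω / c * (y 0 * Real.cos t + y 1 * Real.sin t) - t) := fun y => rfl
  have hΨ' : ∀ y, (fun y : EuclideanSpace ℝ (Fin 2) => ∫ t in (0 : ℝ)..2 * Real.pi,
      (-Real.sin (ω / c * (y 0 * Real.cos t + y 1 * Real.sin t) - t)) • ((ω / c) • (fun t => Real.cos t • (EuclideanSpace.proj (𝕜 := ℝ) (0 : Fin 2) : EuclideanSpace ℝ (Fin 2) →L[ℝ] ℝ) +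
      Real.sin t • (EuclideanSpace.proj (𝕜 := ℝ) (1 : Fin 2) : EuclideanSpace ℝ (Fin 2) →L[ℝ] ℝ)) t)) y = ∫ t in (0 : ℝ)..2 * Real.pi,
      (-Real.sin (ω / c * (y 0 * Real.cos t + y 1 * Real.sin t) - t)) • ((ω / c) • (fun t => Real.cos t • (EuclideanSpace.proj (𝕜 := ℝ) (0 : Fin 2) : EuclideanSpace ℝ (Fin 2) →L[ℝ] ℝ) +
      Real.sin t • (EuclideanSpace.proj (𝕜 := ℝ) (1 : Fin 2) : EuclideanSpace ℝ (Fin 2) →L[ℝ] ℝ)) t) := fun y => rfl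
  have hΨ'' : ∀ y, (fun y : EuclideanSpace ℝ (Fin 2) => ∫ t in (0 : ℝ)..2 * Real.pi,
      (-(Real.cos (ω / c * (y 0 * Real.cos t + y 1 * Real.sin t) - t) • ((ω / c) • (fun t => Real.cos t • (EuclideanSpace.proj (𝕜 := ℝ) (0 : Fin 2) : EuclideanSpace ℝ (Fin 2) →L[ℝ] ℝ) +
      Real.sin t • (EuclideanSpace.proj (𝕜 := ℝ) (1 : Fin 2) : EuclideanSpace ℝ (Fin 2) →L[ℝ] ℝ)) t))).smulRight ((ω / c) • (fun t => Real.cos t • (EuclideanSpace.proj (𝕜 := ℝ) (0 : Fin 2) : EuclideanSpace ℝ (Fin 2) →L[ℝ] ℝ) +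
      Real.sin t • (EuclideanSpace.proj (𝕜 := ℝ) (1 : Fin 2) : EuclideanSpace ℝ (Fin 2) →L[ℝ] ℝ)) t)) y = ∫ t in (0 : ℝ)..2 * Real.pi,
      (-(Real.cos (ω / c * (y 0 * Real.cos t + y 1 * Real.sin t) - t) • ((ω / c) • (fun t => Real.cos t • (EuclideanSpace.proj (𝕜 := ℝ) (0 : Fin 2) : EuclideanSpace ℝ (Fin 2) →L[ℝ] ℝ) +
      Real.sin t • (EuclideanSpace.proj (𝕜 := ℝ) (1 : Fin 2) : EuclideanSpace ℝ (Fin 2) →L[ℝ] ℝ)) t))).smulRight ((ω / c) • (fun t => Real.cos t • (EuclideanSpace.proj (𝕜 := ℝ) (0 : Fin 2) : EuclideanSpace ℝ (Fin 2) →L[ℝ] ℝ) +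
      Real.sin t • (EuclideanSpace.proj (𝕜 := ℝ) (1 : Fin 2) : EuclideanSpace ℝ (Fin 2) →L[ℝ] ℝ)) t) := fun y => rfl
  refine ⟨_, witness_contDiff hL hΨ hΨ' hΨ'', witness_abs_le hΨ, fun y => ?_, witness_not_const hL hΨ hΨ' hk⟩
  rw [witness_angular hJ hL hΨ hΨ' hΨ'' y, witness_divergence hL hΨ hΨ' hΨ'' c y, hck]
  ring

/-- ★ **`rotating_const` IS FALSE WITHOUT THICKNESS.**  All hypotheses of the would-be rotating-rigidity lemma (evidence #47 §3: `C²` profile,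
`C¹` coefficient with ellipticity bounds `0 < γlo ≤ γ ≤ γhi`, one-signed `γ'` — here both signs at once —, the profile equation
`ω² ΘΘΨ = Σᵢ ∂ᵢ(γ(Ψ)∂ᵢΨ)` for `ω ≠ 0`, boundedness of `Ψ`, `DΨ`, `D²Ψ`) EXCEPT the thick clause «`γ' ≠ 0` somewhere on every interval» are
satisfied by the Bessel spiral profile with `γ ≡ c²`, `γ' ≡ 0`, while the conclusion «`ΘΨ ≡ 0`» FAILS.  So the thick clause is load-bearing:
rotating rigidity is a genuinely-nonlinear phenomenon, not a property of the mixed-type operator. [folklore] -/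
theorem rotating_const_false_without_thick {ω c : ℝ} (hω : ω ≠ 0) (hc : c ≠ 0)
    (hJ : ∀ y' : EuclideanSpace ℝ (Fin 2), J y' = (-(y' 1)) • EuclideanSpace.single (0 : Fin 2) (1 : ℝ) +
      (y' 0) • EuclideanSpace.single (1 : Fin 2) (1 : ℝ)) :
    ∃ (Ψ : EuclideanSpace ℝ (Fin 2) → ℝ) (γ γ' : ℝ → ℝ) (γlo γhi MΨ M₁ M₂ : ℝ),
      ContDiff ℝ 2 Ψ ∧ ContDiff ℝ 1 γ ∧
      (∀ y : EuclideanSpace ℝ (Fin 2),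
        ω ^ 2 * fderiv ℝ (fun y' => fderiv ℝ Ψ y' (J y')) y (J y) =
          ∑ i, fderiv ℝ (fun y' => γ (Ψ y') * fderiv ℝ Ψ y' (EuclideanSpace.single i 1)) y (EuclideanSpace.single i 1)) ∧
      0 < γlo ∧ (∀ r, γlo ≤ γ r) ∧ (∀ r, γ r ≤ γhi) ∧ (∀ r, HasDerivAt γ (γ' r) r) ∧ (∀ r, 0 ≤ γ' r) ∧ (∀ r, γ' r ≤ 0) ∧
      (∀ y, |Ψ y| ≤ MΨ) ∧ (∀ y h, |fderiv ℝ Ψ y h| ≤ M₁ * ‖h‖) ∧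
      (∀ y h h', |fderiv ℝ (fun y' => fderiv ℝ Ψ y' h) y h'| ≤ M₂ * ‖h‖ * ‖h'‖) ∧
      ¬ (∀ y : EuclideanSpace ℝ (Fin 2), fderiv ℝ Ψ y (J y) = 0) := by
  have hk : ω / c ≠ 0 := div_ne_zero hω hc
  have hck : c ^ 2 * (ω / c) ^ 2 = ω ^ 2 := by field_simp
  obtain ⟨L, hL⟩ : ∃ L : ℝ → EuclideanSpace ℝ (Fin 2) →L[ℝ] ℝ, ∀ t, L t =
      Real.cos t • (EuclideanSpace.proj (𝕜 := ℝ) (0 : Fin 2) : EuclideanSpace ℝ (Fin 2) →L[ℝ] ℝ) +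
      Real.sin t • (EuclideanSpace.proj (𝕜 := ℝ) (1 : Fin 2) : EuclideanSpace ℝ (Fin 2) →L[ℝ] ℝ) := ⟨_, fun t => rfl⟩
  obtain ⟨Ψ, hΨ⟩ : ∃ Ψ : EuclideanSpace ℝ (Fin 2) → ℝ, ∀ y, Ψ y =
      ∫ t in (0 : ℝ)..2 * Real.pi, Real.cos (ω / c * (y 0 * Real.cos t + y 1 * Real.sin t) - t) := ⟨_, fun y => rfl⟩
  obtain ⟨Ψ', hΨ'⟩ : ∃ Ψ' : EuclideanSpace ℝ (Fin 2) → EuclideanSpace ℝ (Fin 2) →L[ℝ] ℝ, ∀ y, Ψ' y =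
      ∫ t in (0 : ℝ)..2 * Real.pi, (-Real.sin (ω / c * (y 0 * Real.cos t + y 1 * Real.sin t) - t)) • ((ω / c) • L t) :=
    ⟨_, fun y => rfl⟩
  obtain ⟨Ψ'', hΨ''⟩ : ∃ Ψ'' : EuclideanSpace ℝ (Fin 2) → EuclideanSpace ℝ (Fin 2) →L[ℝ] (EuclideanSpace ℝ (Fin 2) →L[ℝ] ℝ),
      ∀ y, Ψ'' y = ∫ t in (0 : ℝ)..2 * Real.pi,
        (-(Real.cos (ω / c * (y 0 * Real.cos t + y 1 * Real.sin t) - t) • ((ω / c) • L t))).smulRight ((ω / c) • L t) :=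
    ⟨_, fun y => rfl⟩
  set C : ℝ := |ω / c| * (‖(EuclideanSpace.proj (𝕜 := ℝ) (0 : Fin 2) : EuclideanSpace ℝ (Fin 2) →L[ℝ] ℝ)‖ +
    ‖(EuclideanSpace.proj (𝕜 := ℝ) (1 : Fin 2) : EuclideanSpace ℝ (Fin 2) →L[ℝ] ℝ)‖) with hC
  refine ⟨Ψ, fun _ => c ^ 2, fun _ => 0, c ^ 2, c ^ 2, 2 * Real.pi, 2 * Real.pi * C, 2 * Real.pi * (C * C),
    witness_contDiff hL hΨ hΨ' hΨ'', contDiff_const, fun y => ?_, lt_of_le_of_ne (sq_nonneg c) (Ne.symm (pow_ne_zero 2 hc)),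
    fun _ => le_rfl, fun _ => le_rfl, fun r => hasDerivAt_const r (c ^ 2), fun _ => le_rfl, fun _ => le_rfl,
    witness_abs_le hΨ, witness_fderiv_abs_le hL hΨ hΨ', witness_fderiv_fderiv_abs_le hL hΨ hΨ' hΨ'',
    witness_angularDeriv_not_zero hJ hL hΨ hΨ' hΨ'' hk⟩
  rw [witness_angular hJ hL hΨ hΨ' hΨ'' y, witness_divergence hL hΨ hΨ' hΨ'' c y, hck]
  ring

end Summit.NavierStokesRegularity.NavierStokesRegularity.Theorems.PoloidalWindowDoorPoloidalWindowRigidityZShockRotatingProfileLinearWitness
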